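import Summits.QuantumFields.YangMills.Theorems.ColdStartUniversalityLatticeLangevinTimeAverageHoeffding
import HarnessLib

/-!
# Route `ColdStartUniversality` (fixed-cut-off SZZ dynamics): HOEFFDING'S INEQUALITY FOR TIME AVERAGES FROM A BOUNDED POISSON CORRECTOR
# (generic form of file 70: the constant is `288·β_u`, `β_u` any sup bound of the corrector)

Helper file (seat `ym-line-csu-p1`, g34; `--supports stmt-QuantumFields-24809`).  File 70 (`measureReal_timeAverage_deviation_le_exp`) gives
`P[|T⁻¹∫₀ᵀ G(U_r)dr − μ_(β')(G)| ≥ ε] ≤ 2e^(−cTε²/(576C))` with the Harris constants `C, c` (volume-dependent).  Its proof uses the corrector `u`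
of `Ĝ = G − μ(G)` only through a sup bound `|u| ≤ β_u` and the mild Poisson relation `κ_s u − u = −∫₀ˢ κ_t Ĝ dt`; this file records that
generic form, so that better (e.g. volume-free) corrector bounds give better constants (next file):
* ★★ `measureReal_timeAverage_deviation_le_exp_of_corrector_of_prog` — for every realising kernel family `κ`, every measurable `u` with
  `|u| ≤ β_u` solving the mild Poisson equation for `Ĝ`, every progressively measurable strong solution from a deterministic start on ANY space,
  every continuous `G` with `|G| ≤ 1` and all `T, ε > 0`: `P[|T⁻¹∫_(0,T] G(U_r)dr − μ_(β')(G)| ≥ ε] ≤ 2·exp(−Tε²/(288 β_u))`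
  (increments `u(U_((k+1)h)) − u(U_(kh)) + ∫ Ĝ(U_r)dr`, files 68/69, exactly as in file 70);
* ★★ `measureReal_timeAverage_deviation_le_exp_of_corrector` — the same for EVERY strong solution (regular flow + pathwise uniqueness).
[cite: GlynnOrmoneit2002, Theorem 2] [cite: ChoiLi2019, Theorem 1.1].  THEOREMS ONLY, no definition, no sorry.  HONEST FRAMING: fixed cut-off;
`UniformColdStartMixing` (24809) is NOT restated; no crux, rung or summit statement is proved; the Yang–Mills mass gap is NOT proved.
-/

set_option autoImplicit false

noncomputable section

namespace Summit.QuantumFields.YangMills.Theorems.ColdStartUniversality.LiebRobinson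

open MeasureTheory ProbabilityTheory Filter Topology Set
open scoped NNReal ENNReal BigOperators
open Literature Literature.Probability.Process Literature.MathematicalPhysics.QuantumFieldTheory
open Literature.MathematicalPhysics.QuantumFieldTheory.Balaban1983to89
open Literature.MathematicalPhysics.QuantumLattice (fundamentalRep fundamentalLatticeRep continuous_fundamentalRep fundamentalRep_apply)

variable {L : ℕ} [NeZero L]

/-! ## §1. Generic: Hoeffding for time averages from a bounded mild Poisson corrector -/

/-- ★★ **Hoeffding's inequality for time averages from a bounded corrector (progressively measurable solutions).**  Let `κ` be a realising
Markov kernel family of the SU(2) SZZ dynamics, `G` continuous with `|G| ≤ 1`, and `u` measurable with `|u| ≤ β_u` (`β_u > 0`) solving the mild Poisson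
equation `κ_s u − u = −∫₀ˢ κ_t (G − μ_(β')G) dt` for all `s`.  Then for every strong solution `U` from a deterministic start whose restrictions to
`[0,i] × Ω` are `𝓑([0,i]) ⊗ 𝓕^W_i`-measurable and all `T, ε > 0`:
`P[|T⁻¹∫_(0,T] G(U_r)dr − μ_(β')(G)| ≥ ε] ≤ 2·exp(−T·ε²/(288·β_u))`. [cite: GlynnOrmoneit2002, Theorem 2] [cite: ChoiLi2019, Theorem 1.1] -/
theorem measureReal_timeAverage_deviation_le_exp_of_corrector_of_prog (β' : ℝ)
    (κ : ℝ≥0 → Kernel (GaugeConfig 3 L (Matrix.specialUnitaryGroup (Fin 2) ℂ))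
      (GaugeConfig 3 L (Matrix.specialUnitaryGroup (Fin 2) ℂ))) [∀ t, IsMarkovKernel (κ t)]
    (hreal : ∀ (t : ℝ≥0) (x : GaugeConfig 3 L (Matrix.specialUnitaryGroup (Fin 2) ℂ))
        (Ω : Type) [MeasurableSpace Ω] (P : Measure Ω) [IsProbabilityMeasure P]
        (W : ℝ≥0 → Ω → (Edge 3 L × NoiseIdx 2 → ℝ)) (hW : IsFlatBrownian W P)
        (U : ℝ≥0 → Ω → GaugeConfig 3 L (Matrix.specialUnitaryGroup (Fin 2) ℂ)),
        (∀ ω, U 0 ω = x) →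
        (latticeLangevinDynamics (fundamentalLatticeRep 2) β').IsSolution (fundamentalRep (Fin 2))
          hW.natFiltration P W U →
        κ t x = P.map (U t))
    {G : GaugeConfig 3 L (Matrix.specialUnitaryGroup (Fin 2) ℂ) → ℝ} (hG : Continuous G) (hG1 : ∀ z, |G z| ≤ 1)
    {u : GaugeConfig 3 L (Matrix.specialUnitaryGroup (Fin 2) ℂ) → ℝ} (hum : Measurable u) {βu : ℝ} (hβu : 0 < βu) (hu_b : ∀ y, |u y| ≤ βu)
    (hPois : ∀ (s : ℝ≥0) (y : GaugeConfig 3 L (Matrix.specialUnitaryGroup (Fin 2) ℂ)),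
      (∫ z, u z ∂(κ s y)) - u y = -∫ t in (0 : ℝ)..(s : ℝ),
        (∫ z, (G z - ∫ z', G z' ∂(wilsonMeasure (d := 3) (L := L) (fundamentalRep (Fin 2)) β')) ∂(κ t.toNNReal y)))
    (x : GaugeConfig 3 L (Matrix.specialUnitaryGroup (Fin 2) ℂ))
    {Ω : Type} [MeasurableSpace Ω] {P : Measure Ω} [IsProbabilityMeasure P]
    {W : ℝ≥0 → Ω → (Edge 3 L × NoiseIdx 2 → ℝ)} (hW : IsFlatBrownian W P)
    {U : ℝ≥0 → Ω → GaugeConfig 3 L (Matrix.specialUnitaryGroup (Fin 2) ℂ)} (hU0 : ∀ ω, U 0 ω = x)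
    (hU : (latticeLangevinDynamics (fundamentalLatticeRep 2) β').IsSolution (fundamentalRep (Fin 2)) hW.natFiltration P W U)
    (hprog : ∀ i : ℝ≥0, Measurable[@Prod.instMeasurableSpace (Set.Iic i) Ω inferInstance (hW.natFiltration i)]
      (fun q : Set.Iic i × Ω => U q.1 q.2))
    {T : ℝ} (hT : 0 < T) {ε : ℝ} (hε : 0 < ε) :
    P.real {ω | ε ≤ |T⁻¹ * (∫ r in Ioc 0 T, G (U r.toNNReal ω)) - ∫ z, G z ∂(wilsonMeasure (d := 3) (L := L) (fundamentalRep (Fin 2)) β')|} ≤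
      2 * Real.exp (-(T * ε ^ 2) / (288 * βu)) := by
  classical
  haveI := secondCountableTopology_su2
  haveI := borelSpace_config L
  haveI : IsProbabilityMeasure (wilsonMeasure (d := 3) (L := L) (fundamentalRep (Fin 2)) β') :=
    isProbabilityMeasure_wilsonMeasure (d := 3) (L := L) (fundamentalRep (Fin 2)) (continuous_fundamentalRep (Fin 2)) β'
  set m : ℝ := ∫ z, G z ∂(wilsonMeasure (d := 3) (L := L) (fundamentalRep (Fin 2)) β') with hm
  have hGm : Measurable G := hG.measurable
  have hm1 : |m| ≤ 1 := by
    have hh := norm_integral_le_of_norm_le_const (μ := wilsonMeasure (d := 3) (L := L) (fundamentalRep (Fin 2)) β') (f := G) (C := 1)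
      (Eventually.of_forall fun z => by simpa [Real.norm_eq_abs] using hG1 z)
    simpa [Real.norm_eq_abs] using hh
  /- ### 1. Realising kernels and the Poisson corrector of `Ĝ = G − m` -/
  set Gh : GaugeConfig 3 L (Matrix.specialUnitaryGroup (Fin 2) ℂ) → ℝ := fun z => G z - m with hGh
  have hGhc : Continuous Gh := hG.sub continuous_const
  have hGhm : Measurable Gh := hGhc.measurable
  have hGhb : ∀ z, |Gh z| ≤ 2 := fun z => (abs_sub _ _).trans (by linarith [hG1 z, hm1])
  have hGh0 : ∫ z, Gh z ∂(wilsonMeasure (d := 3) (L := L) (fundamentalRep (Fin 2)) β') = 0 := by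
    have hGi : Integrable G (wilsonMeasure (d := 3) (L := L) (fundamentalRep (Fin 2)) β') :=
      (integrable_const (1 : ℝ)).mono' hGm.aestronglyMeasurable (Eventually.of_forall fun z => by simpa [Real.norm_eq_abs] using hG1 z)
    simp only [hGh]
    rw [integral_sub hGi (integrable_const m), integral_const, smul_eq_mul, probReal_univ, one_mul, hm, sub_self]
  set b : ℝ := 2 * βu with hb
  have hb0 : 0 < b := by positivity
  have hub : ∀ y y', |u y - u y'| ≤ b := fun y y' => by
    have h1 := hu_b y
    have h2 := hu_b y'
    rw [hb]
    calc |u y - u y'| ≤ |u y| + |u y'| := abs_sub _ _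
      _ ≤ βu + βu := add_le_add h1 h2
      _ = 2 * βu := by ring
  /- ### 2. The grid `t_k = k·h`, `h = T/N`, `N = ⌈T/b⌉` -/
  set N : ℕ := ⌈T / b⌉₊ with hN
  have hTb : 0 < T / b := div_pos hT hb0
  have hN0 : 0 < N := Nat.ceil_pos.2 hTb
  have hNr : (0 : ℝ) < N := by exact_mod_cast hN0
  have hNge : T / b ≤ N := Nat.le_ceil _
  have hNlt : (N : ℝ) < T / b + 1 := Nat.ceil_lt_add_one hTb.le
  set h : ℝ := T / N with hh
  have hh0 : 0 < h := div_pos hT hNr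
  have hhb : h ≤ b := by
    rw [hh, div_le_iff₀ hNr]
    calc T = T / b * b := by field_simp
      _ ≤ N * b := by gcongr
      _ = b * N := mul_comm _ _
  have hNh : (N : ℝ) * h = T := by rw [hh]; field_simp
  set t : ℕ → ℝ := fun k => (k : ℝ) * h with ht
  have ht0 : ∀ k, 0 ≤ t k := fun k => by positivity
  have htsucc : ∀ k, t (k + 1) = t k + h := fun k => by simp only [ht]; push_cast; ring
  have htmono : ∀ k, t k ≤ t (k + 1) := fun k => by rw [htsucc]; linarith
  have htle : ∀ j k : ℕ, j ≤ k → t j ≤ t k := fun j k hjk => by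
    simp only [ht]
    exact mul_le_mul_of_nonneg_right (by exact_mod_cast hjk) hh0.le
  have htNN : ∀ k, (t (k + 1)).toNNReal = (t k).toNNReal + h.toNNReal := fun k => by
    rw [htsucc, Real.toNNReal_add (ht0 k) hh0.le]
  /- ### 3. Measurability -/
  have hJ : Measurable fun q : Ω × ℝ => U q.2.toNNReal q.1 :=
    measurable_uncurry_of_prog (Z := U) (fun n : ℕ => hW.natFiltration n) (fun n => hW.natFiltration.le n) (fun n => hprog n)
  have hmU : ∀ s : ℝ≥0, Measurable (U s) := fun s => (hU.adapted s).mono (hW.natFiltration.le s) le_rfl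
  have hsec : ∀ ω, Measurable fun r : ℝ => U r.toNNReal ω := fun ω => hJ.comp (measurable_const.prodMk measurable_id)
  -- bounded measurable sections are interval integrable
  have hii : ∀ (φ : GaugeConfig 3 L (Matrix.specialUnitaryGroup (Fin 2) ℂ) → ℝ) (Cφ : ℝ), Measurable φ → (∀ z, |φ z| ≤ Cφ) →
      ∀ ω (a a' : ℝ), IntervalIntegrable (fun r => φ (U r.toNNReal ω)) volume a a' := by
    intro φ Cφ hφ hφb ω a a'
    exact (intervalIntegrable_const (c := Cφ)).mono_fun' ((hφ.comp (hsec ω)).aestronglyMeasurable)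
      (ae_of_all _ fun r => by simp only [Real.norm_eq_abs]; exact hφb _)
  /- ### 4. The increments -/
  set D : ℕ → Ω → ℝ := fun k ω =>
    u (U (t (k + 1)).toNNReal ω) - u (U (t k).toNNReal ω) + ∫ r in Ioc (t k) (t (k + 1)), Gh (U r.toNNReal ω) with hD
  -- adaptedness (the path integral through the progressive measurability of `U`, file 69)
  have hIF : ∀ k, Measurable[hW.natFiltration (t (k + 1)).toNNReal] fun ω => ∫ r in Ioc (t k) (t (k + 1)), Gh (U r.toNNReal ω) :=
    fun k => measurable_setIntegral_path (mΩ := hW.natFiltration (t (k + 1)).toNNReal) (t (k + 1)).toNNReal (hprog _) hGhm (ht0 k)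
      (by rw [Real.coe_toNNReal _ (ht0 (k + 1))])
  have hIm : ∀ k, Measurable fun ω => ∫ r in Ioc (t k) (t (k + 1)), Gh (U r.toNNReal ω) :=
    fun k => (hIF k).mono (hW.natFiltration.le _) le_rfl
  have hDF : ∀ k, Measurable[hW.natFiltration (t (k + 1)).toNNReal] (D k) := by
    intro k
    have h1 : Measurable[hW.natFiltration (t (k + 1)).toNNReal] fun ω => u (U (t (k + 1)).toNNReal ω) := hum.comp (hU.adapted _)
    have h2 : Measurable[hW.natFiltration (t (k + 1)).toNNReal] fun ω => u (U (t k).toNNReal ω) :=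
      (hum.comp (hU.adapted _)).mono (hW.natFiltration.mono (Real.toNNReal_le_toNNReal (htmono k))) le_rfl
    exact (h1.sub h2).add (hIF k)
  have hDm : ∀ k, Measurable (D k) := fun k => (hDF k).mono (hW.natFiltration.le _) le_rfl
  -- boundedness
  set B : ℝ := b + 2 * h with hB
  have hB0 : 0 < B := by positivity
  have hIb : ∀ k ω, |∫ r in Ioc (t k) (t (k + 1)), Gh (U r.toNNReal ω)| ≤ 2 * h := fun k ω => by
    have hh' := norm_setIntegral_le_of_norm_le_const (μ := volume) (s := Ioc (t k) (t (k + 1))) measure_Ioc_lt_top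
      (fun r _ => show ‖Gh (U r.toNNReal ω)‖ ≤ 2 by rw [Real.norm_eq_abs]; exact hGhb _) (f := fun r => Gh (U r.toNNReal ω))
    have hvol : volume.real (Ioc (t k) (t (k + 1))) = h := by rw [Real.volume_real_Ioc_of_le (htmono k), htsucc]; ring
    rw [Real.norm_eq_abs, hvol] at hh'
    exact hh'
  have hDb : ∀ k ω, |D k ω| ≤ B := fun k ω => by
    simp only [hD, hB]
    exact (abs_add_le _ _).trans (add_le_add (hub _ _) (hIb k ω))
  /- ### 5. Orthogonality of the increments (Markov property + Poisson equation) -/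
  have horth : ∀ k < N, ∀ l : ℝ, ∫ ω, Real.exp (l * ∑ j ∈ Finset.range k, D j ω) * D k ω ∂P = 0 := by
    intro k _ l
    set Z : Ω → ℝ := fun ω => Real.exp (l * ∑ j ∈ Finset.range k, D j ω) with hZ
    -- `Z` is `𝓕_(t_k)`-measurable and bounded
    have hSF : Measurable[hW.natFiltration (t k).toNNReal] fun ω => ∑ j ∈ Finset.range k, D j ω := by
      refine Finset.measurable_sum (Finset.range k) fun j hj => ?_
      have hjk : (t (j + 1)).toNNReal ≤ (t k).toNNReal :=
        Real.toNNReal_le_toNNReal (htle (j + 1) k (Nat.succ_le_of_lt (Finset.mem_range.1 hj)))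
      exact (hDF j).mono (hW.natFiltration.mono hjk) le_rfl
    have hZF : Measurable[hW.natFiltration (t k).toNNReal] Z := (hSF.const_mul l).exp
    have hZm : Measurable Z := hZF.mono (hW.natFiltration.le _) le_rfl
    have hSb : ∀ ω, |∑ j ∈ Finset.range k, D j ω| ≤ k * B := fun ω =>
      (Finset.abs_sum_le_sum_abs _ _).trans (by
        calc ∑ j ∈ Finset.range k, |D j ω| ≤ ∑ _j ∈ Finset.range k, B := Finset.sum_le_sum fun j _ => hDb j ω
          _ = k * B := by rw [Finset.sum_const, Finset.card_range, nsmul_eq_mul])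
    have hZb : ∀ ω, |Z ω| ≤ Real.exp (|l| * (k * B)) := fun ω => by
      rw [hZ, abs_of_pos (Real.exp_pos _), Real.exp_le_exp]
      calc l * ∑ j ∈ Finset.range k, D j ω ≤ |l * ∑ j ∈ Finset.range k, D j ω| := le_abs_self _
        _ = |l| * |∑ j ∈ Finset.range k, D j ω| := abs_mul _ _
        _ ≤ |l| * (k * B) := mul_le_mul_of_nonneg_left (hSb ω) (abs_nonneg l)
    -- (a) `E[Z u(U_(t_(k+1)))] = E[Z κ_h u(U_(t_k))]`
    have e1 : ∫ ω, Z ω * u (U (t (k + 1)).toNNReal ω) ∂P =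
        ∫ ω, Z ω * (∫ z, u z ∂(κ h.toNNReal (U (t k).toNNReal ω))) ∂P := by
      rw [htNN k]
      exact integral_mul_comp_add_eq_integral_mul_transition β' κ hreal x hW hU0 hU (t k).toNNReal h.toNNReal hZF hZb hum hu_b
    -- (b) `E[Z ∫ Ĝ(U_r) dr] = E[Z ∫₀ʰ κ_v Ĝ(U_(t_k)) dv]`
    have e2 : ∫ ω, Z ω * (∫ r in Ioc (t k) (t (k + 1)), Gh (U r.toNNReal ω)) ∂P =
        ∫ ω, Z ω * (∫ v in Ioc (0 : ℝ) h, ∫ z, Gh z ∂(κ v.toNNReal (U (t k).toNNReal ω))) ∂P := by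
      have hIoc : Ioc (t k) (t (k + 1)) = Ioc (((t k).toNNReal : ℝ≥0) : ℝ) (((t k).toNNReal : ℝ≥0) + h) := by
        rw [Real.coe_toNNReal _ (ht0 k), htsucc]
      rw [hIoc]
      exact integral_mul_setIntegral_comp_eq_integral_mul_setIntegral_transition β' κ hreal x hW hU0 hU hJ (t k).toNNReal hh0.le
        hZF hZb hGhc hGhb
    -- (c) the Poisson equation: `∫₀ʰ κ_v Ĝ(y) dv = u(y) − κ_h u(y)`
    have e3 : ∀ y, (∫ v in Ioc (0 : ℝ) h, ∫ z, Gh z ∂(κ v.toNNReal y)) = u y - ∫ z, u z ∂(κ h.toNNReal y) := fun y => by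
      have hp := hPois h.toNNReal y
      rw [Real.coe_toNNReal _ hh0.le] at hp
      rw [← intervalIntegral.integral_of_le hh0.le]
      linarith
    -- integrability of the bounded products
    have hκub : ∀ y, |∫ z, u z ∂(κ h.toNNReal y)| ≤ βu := fun y => by
      have hh' := norm_integral_le_of_norm_le_const (μ := κ h.toNNReal y) (f := u) (C := βu)
        (Eventually.of_forall fun z => by simpa [Real.norm_eq_abs] using hu_b z)
      simpa [Real.norm_eq_abs] using hh'
    have hκum : Measurable fun y => ∫ z, u z ∂(κ h.toNNReal y) := (hum.stronglyMeasurable.integral_kernel (κ := κ h.toNNReal)).measurable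
    have hInt : ∀ {φ : Ω → ℝ} {Cφ : ℝ}, Measurable φ → (∀ ω, |φ ω| ≤ Cφ) → Integrable (fun ω => Z ω * φ ω) P :=
      fun {φ Cφ} hφ hφb => (integrable_const (Real.exp (|l| * (k * B)) * Cφ)).mono' (hZm.mul hφ).aestronglyMeasurable
        (Eventually.of_forall fun ω => by
          rw [norm_mul, Real.norm_eq_abs, Real.norm_eq_abs]
          exact mul_le_mul (hZb ω) (hφb ω) (abs_nonneg _) (Real.exp_pos _).le)
    have i1 : Integrable (fun ω => Z ω * u (U (t (k + 1)).toNNReal ω)) P := hInt (hum.comp (hmU _)) fun ω => hu_b _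
    have i2 : Integrable (fun ω => Z ω * u (U (t k).toNNReal ω)) P := hInt (hum.comp (hmU _)) fun ω => hu_b _
    have i3 : Integrable (fun ω => Z ω * ∫ r in Ioc (t k) (t (k + 1)), Gh (U r.toNNReal ω)) P := hInt (hIm k) (hIb k)
    have i4 : Integrable (fun ω => Z ω * ∫ z, u z ∂(κ h.toNNReal (U (t k).toNNReal ω))) P := hInt (hκum.comp (hmU _)) fun ω => hκub _
    -- assemble
    have hsplit : ∫ ω, Z ω * D k ω ∂P = (∫ ω, Z ω * u (U (t (k + 1)).toNNReal ω) ∂P) - (∫ ω, Z ω * u (U (t k).toNNReal ω) ∂P) +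
        ∫ ω, Z ω * (∫ r in Ioc (t k) (t (k + 1)), Gh (U r.toNNReal ω)) ∂P := by
      have hpt : ∀ ω, Z ω * D k ω = (Z ω * u (U (t (k + 1)).toNNReal ω) - Z ω * u (U (t k).toNNReal ω)) +
          Z ω * (∫ r in Ioc (t k) (t (k + 1)), Gh (U r.toNNReal ω)) := fun ω => by simp only [hD]; ring
      rw [integral_congr_ae (ae_of_all _ hpt),
        integral_add (f := fun ω => Z ω * u (U (t (k + 1)).toNNReal ω) - Z ω * u (U (t k).toNNReal ω)) (i1.sub i2) i3,
        integral_sub i1 i2]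
    have e23 : ∫ ω, Z ω * (∫ v in Ioc (0 : ℝ) h, ∫ z, Gh z ∂(κ v.toNNReal (U (t k).toNNReal ω))) ∂P =
        (∫ ω, Z ω * u (U (t k).toNNReal ω) ∂P) - ∫ ω, Z ω * (∫ z, u z ∂(κ h.toNNReal (U (t k).toNNReal ω))) ∂P := by
      rw [← integral_sub i2 i4]
      exact integral_congr_ae (ae_of_all _ fun ω => by dsimp only; rw [e3, mul_sub])
    rw [hsplit, e1, e2, e23]
    ring
  /- ### 6. Azuma–Hoeffding for the increments (file 68) -/
  have htail : ∀ {r : ℝ}, 0 ≤ r → P.real {ω | r ≤ |∑ j ∈ Finset.range N, D j ω|} ≤ 2 * Real.exp (-r ^ 2 / (2 * (N * B ^ 2))) :=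
    fun {r} hr => measureReal_abs_sum_ge_le_of_orthogonal D hDm hB0 hDb N horth hr
  /- ### 7. Telescoping: `Σ_(k<N) D_k = u(U_T) − u(x) + ∫_(0,T] Ĝ(U_r) dr`, and the deviation event -/
  have hsum : ∀ ω, ∑ j ∈ Finset.range N, D j ω =
      u (U (t N).toNNReal ω) - u (U (t 0).toNNReal ω) + ∫ r in Ioc 0 T, Gh (U r.toNNReal ω) := by
    intro ω
    have h1 : ∑ j ∈ Finset.range N, D j ω = ∑ j ∈ Finset.range N, (u (U (t (j + 1)).toNNReal ω) - u (U (t j).toNNReal ω)) +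
        ∑ j ∈ Finset.range N, ∫ r in Ioc (t j) (t (j + 1)), Gh (U r.toNNReal ω) := by
      rw [← Finset.sum_add_distrib]
    have h2 : ∑ j ∈ Finset.range N, ∫ r in Ioc (t j) (t (j + 1)), Gh (U r.toNNReal ω) = ∫ r in Ioc 0 T, Gh (U r.toNNReal ω) := by
      have h3 : ∑ j ∈ Finset.range N, ∫ r in (t j)..(t (j + 1)), Gh (U r.toNNReal ω) = ∫ r in (t 0)..(t N), Gh (U r.toNNReal ω) :=
        intervalIntegral.sum_integral_adjacent_intervals fun j _ => hii Gh 2 hGhm hGhb ω _ _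
      have ht00 : t 0 = 0 := by simp [ht]
      have htN : t N = T := hNh
      rw [Finset.sum_congr rfl fun j _ => intervalIntegral.integral_of_le (htmono j), ht00, htN,
        intervalIntegral.integral_of_le hT.le] at h3
      exact h3
    rw [h1, Finset.sum_range_sub (fun j => u (U (t j).toNNReal ω)), h2]
  -- centring of the time average
  have hcent : ∀ ω, T⁻¹ * (∫ r in Ioc 0 T, G (U r.toNNReal ω)) - m = T⁻¹ * ∫ r in Ioc 0 T, Gh (U r.toNNReal ω) := by
    intro ω
    have hGi : IntegrableOn (fun r : ℝ => G (U r.toNNReal ω)) (Ioc 0 T) volume := (hii G 1 hGm hG1 ω 0 T).1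
    have hsub : ∫ r in Ioc 0 T, Gh (U r.toNNReal ω) = (∫ r in Ioc 0 T, G (U r.toNNReal ω)) - T * m := by
      show ∫ r in Ioc 0 T, (G (U r.toNNReal ω) - m) = _
      rw [integral_sub hGi (integrableOn_const measure_Ioc_lt_top.ne), setIntegral_const, smul_eq_mul,
        Real.volume_real_Ioc_of_le hT.le, sub_zero]
    rw [hsub, mul_sub, ← mul_assoc, inv_mul_cancel₀ hT.ne', one_mul]
  have havg : ∀ ω, |T⁻¹ * ∫ r in Ioc 0 T, G (U r.toNNReal ω)| ≤ 1 := fun ω => by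
    have hh' := norm_setIntegral_le_of_norm_le_const (μ := volume) (s := Ioc 0 T) measure_Ioc_lt_top
      (fun r _ => show ‖G (U r.toNNReal ω)‖ ≤ 1 by rw [Real.norm_eq_abs]; exact hG1 _) (f := fun r => G (U r.toNNReal ω))
    rw [Real.norm_eq_abs, Real.volume_real_Ioc_of_le hT.le, sub_zero] at hh'
    rw [abs_mul, abs_inv, abs_of_pos hT]
    calc T⁻¹ * |∫ r in Ioc 0 T, G (U r.toNNReal ω)| ≤ T⁻¹ * (1 * T) := mul_le_mul_of_nonneg_left hh' (inv_nonneg.2 hT.le)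
      _ = 1 := by field_simp
  -- the event inclusion `{ε ≤ |avg − m|} ⊆ {Tε − b ≤ |Σ D_k|}`
  have hincl : {ω | ε ≤ |T⁻¹ * (∫ r in Ioc 0 T, G (U r.toNNReal ω)) - m|} ⊆
      {ω | T * ε - b ≤ |∑ j ∈ Finset.range N, D j ω|} := by
    intro ω hω
    simp only [Set.mem_setOf_eq] at hω ⊢
    rw [hcent ω, abs_mul, abs_inv, abs_of_pos hT] at hω
    have hTI : T * ε ≤ |∫ r in Ioc 0 T, Gh (U r.toNNReal ω)| := by
      have := mul_le_mul_of_nonneg_left hω hT.le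
      rwa [← mul_assoc, mul_inv_cancel₀ hT.ne', one_mul] at this
    have hI : ∫ r in Ioc 0 T, Gh (U r.toNNReal ω) =
        (∑ j ∈ Finset.range N, D j ω) - (u (U (t N).toNNReal ω) - u (U (t 0).toNNReal ω)) := by
      rw [hsum ω]; ring
    rw [hI] at hTI
    have := abs_sub (∑ j ∈ Finset.range N, D j ω) (u (U (t N).toNNReal ω) - u (U (t 0).toNNReal ω))
    linarith [hub (U (t N).toNNReal ω) (U (t 0).toNNReal ω)]
  /- ### 8. Arithmetic -/
  have hKb : T * ε ^ 2 / (288 * βu) = T * ε ^ 2 / (144 * b) := by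
    rw [hb]
    ring
  by_cases hε2 : 2 < ε
  · -- the deviation never exceeds 2
    have hempty : {ω | ε ≤ |T⁻¹ * (∫ r in Ioc 0 T, G (U r.toNNReal ω)) - m|} = ∅ := by
      refine Set.eq_empty_iff_forall_notMem.2 fun ω hω => ?_
      simp only [Set.mem_setOf_eq] at hω
      have h3 : |T⁻¹ * (∫ r in Ioc 0 T, G (U r.toNNReal ω)) - m| ≤ 2 := (abs_sub _ _).trans (by linarith [havg ω, hm1])
      linarith
    rw [hempty, measureReal_empty]
    positivity
  push Not at hε2
  by_cases hbig : b ≤ T ∧ 2 * b ≤ T * ε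
  · obtain ⟨hbT, hbTε⟩ := hbig
    have hr : 0 ≤ T * ε - b := by linarith
    refine (measureReal_mono hincl).trans ((htail hr).trans ?_)
    refine mul_le_mul_of_nonneg_left (Real.exp_le_exp.2 ?_) (by norm_num)
    -- `T ε²/(288 β_u) = T ε²/(144 b) ≤ (Tε − b)²/(2 N B²)`
    rw [neg_div, neg_div, neg_le_neg_iff, hKb]
    have hB3 : B ≤ 3 * b := by rw [hB]; linarith
    have hNb : (N : ℝ) * b ≤ T + b := by
      have h1 := mul_lt_mul_of_pos_right hNlt hb0
      rw [add_mul, div_mul_cancel₀ _ hb0.ne', one_mul] at h1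
      exact h1.le
    have hden : 2 * (N * B ^ 2) ≤ 36 * b * T := by
      calc 2 * (N * B ^ 2) ≤ 2 * (N * (3 * b) ^ 2) := by gcongr
        _ = 18 * b * (N * b) := by ring
        _ ≤ 18 * b * (T + b) := by gcongr
        _ ≤ 18 * b * (T + T) := by gcongr
        _ = 36 * b * T := by ring
    have hden0 : 0 < 2 * (N * B ^ 2) := by positivity
    have hnum : T ^ 2 * ε ^ 2 / 4 ≤ (T * ε - b) ^ 2 := by nlinarith
    calc T * ε ^ 2 / (144 * b) = (T ^ 2 * ε ^ 2 / 4) / (36 * b * T) := by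
          rw [div_eq_div_iff (by positivity) (by positivity)]
          ring
      _ ≤ (T ^ 2 * ε ^ 2 / 4) / (2 * (N * B ^ 2)) := div_le_div_of_nonneg_left (by positivity) hden0 hden
      _ ≤ (T * ε - b) ^ 2 / (2 * (N * B ^ 2)) := div_le_div_of_nonneg_right hnum hden0.le
  · -- small `T` or small `Tε`: the right-hand side exceeds `1`
    have hTε2 : T * ε ^ 2 < 4 * b := by
      rcases not_and_or.1 hbig with h1 | h1
      · push Not at h1
        calc T * ε ^ 2 ≤ T * 2 ^ 2 := by gcongr
          _ < b * 2 ^ 2 := by gcongr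
          _ = 4 * b := by ring
      · push Not at h1
        calc T * ε ^ 2 = (T * ε) * ε := by ring
          _ ≤ (T * ε) * 2 := by gcongr
          _ < (2 * b) * 2 := by gcongr
          _ = 4 * b := by ring
    have hexp : (1 : ℝ) ≤ 2 * Real.exp (-(T * ε ^ 2) / (288 * βu)) := by
      rw [neg_div, hKb]
      have hy : T * ε ^ 2 / (144 * b) ≤ 1 / 36 := by
        rw [div_le_div_iff₀ (by positivity) (by norm_num)]
        linarith
      have h1 := Real.add_one_le_exp (-(T * ε ^ 2 / (144 * b)))
      linarith
    exact measureReal_le_one.trans hexp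

/-- ★★ **Hoeffding's inequality for time averages from a bounded corrector (EVERY strong solution).**  As
`measureReal_timeAverage_deviation_le_exp_of_corrector_of_prog`, for every strong solution from a deterministic start on ANY probability space
(regular flow + pathwise uniqueness). [cite: GlynnOrmoneit2002, Theorem 2] [cite: ChoiLi2019, Theorem 1.1] -/
theorem measureReal_timeAverage_deviation_le_exp_of_corrector (β' : ℝ)
    (κ : ℝ≥0 → Kernel (GaugeConfig 3 L (Matrix.specialUnitaryGroup (Fin 2) ℂ))
      (GaugeConfig 3 L (Matrix.specialUnitaryGroup (Fin 2) ℂ))) [∀ t, IsMarkovKernel (κ t)]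
    (hreal : ∀ (t : ℝ≥0) (x : GaugeConfig 3 L (Matrix.specialUnitaryGroup (Fin 2) ℂ))
        (Ω : Type) [MeasurableSpace Ω] (P : Measure Ω) [IsProbabilityMeasure P]
        (W : ℝ≥0 → Ω → (Edge 3 L × NoiseIdx 2 → ℝ)) (hW : IsFlatBrownian W P)
        (U : ℝ≥0 → Ω → GaugeConfig 3 L (Matrix.specialUnitaryGroup (Fin 2) ℂ)),
        (∀ ω, U 0 ω = x) →
        (latticeLangevinDynamics (fundamentalLatticeRep 2) β').IsSolution (fundamentalRep (Fin 2))
          hW.natFiltration P W U →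
        κ t x = P.map (U t))
    {G : GaugeConfig 3 L (Matrix.specialUnitaryGroup (Fin 2) ℂ) → ℝ} (hG : Continuous G) (hG1 : ∀ z, |G z| ≤ 1)
    {u : GaugeConfig 3 L (Matrix.specialUnitaryGroup (Fin 2) ℂ) → ℝ} (hum : Measurable u) {βu : ℝ} (hβu : 0 < βu) (hu_b : ∀ y, |u y| ≤ βu)
    (hPois : ∀ (s : ℝ≥0) (y : GaugeConfig 3 L (Matrix.specialUnitaryGroup (Fin 2) ℂ)),
      (∫ z, u z ∂(κ s y)) - u y = -∫ t in (0 : ℝ)..(s : ℝ),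
        (∫ z, (G z - ∫ z', G z' ∂(wilsonMeasure (d := 3) (L := L) (fundamentalRep (Fin 2)) β')) ∂(κ t.toNNReal y)))
    (x : GaugeConfig 3 L (Matrix.specialUnitaryGroup (Fin 2) ℂ))
    {Ω : Type} [MeasurableSpace Ω] {P : Measure Ω} [IsProbabilityMeasure P]
    {W : ℝ≥0 → Ω → (Edge 3 L × NoiseIdx 2 → ℝ)} (hW : IsFlatBrownian W P)
    {U : ℝ≥0 → Ω → GaugeConfig 3 L (Matrix.specialUnitaryGroup (Fin 2) ℂ)} (hU0 : ∀ ω, U 0 ω = x)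
    (hU : (latticeLangevinDynamics (fundamentalLatticeRep 2) β').IsSolution (fundamentalRep (Fin 2)) hW.natFiltration P W U)
    {T : ℝ} (hT : 0 < T) {ε : ℝ} (hε : 0 < ε) :
    P.real {ω | ε ≤ |T⁻¹ * (∫ r in Ioc 0 T, G (U r.toNNReal ω)) - ∫ z, G z ∂(wilsonMeasure (d := 3) (L := L) (fundamentalRep (Fin 2)) β')|} ≤
      2 * Real.exp (-(T * ε ^ 2) / (288 * βu)) := by
  classical
  obtain ⟨V, -, hV, hVprog, -, -, -⟩ := exists_regularFlow L β' hW
  have hprog : ∀ i : ℝ≥0, Measurable[@Prod.instMeasurableSpace (Set.Iic i) Ω inferInstance (hW.natFiltration i)]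
      (fun q : Set.Iic i × Ω => V x q.1 q.2) := fun i =>
    (hVprog i).comp (measurable_fst.prodMk (measurable_const.prodMk measurable_snd))
  have hmain := measureReal_timeAverage_deviation_le_exp_of_corrector_of_prog β' κ hreal hG hG1 hum hβu hu_b hPois x hW (hV x).1 (hV x).2
    hprog hT hε
  have hae := latticeLangevin_pathwise_unique hW β' x hU0 (hV x).1 hU (hV x).2
  have hset : {ω | ε ≤ |T⁻¹ * (∫ r in Ioc 0 T, G (U r.toNNReal ω)) - ∫ z, G z ∂(wilsonMeasure (d := 3) (L := L) (fundamentalRep (Fin 2)) β')|} =ᵐ[P]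
      {ω | ε ≤ |T⁻¹ * (∫ r in Ioc 0 T, G (V x r.toNNReal ω)) - ∫ z, G z ∂(wilsonMeasure (d := 3) (L := L) (fundamentalRep (Fin 2)) β')|} := by
    refine Filter.eventuallyEq_set.2 ?_
    filter_upwards [hae] with ω hω
    have hfun : (fun r : ℝ => G (U r.toNNReal ω)) = fun r : ℝ => G (V x r.toNNReal ω) := funext fun r => by rw [hω]
    simp only [hfun]
  rw [measureReal_congr hset]
  exact hmain

end Summit.QuantumFields.YangMills.Theorems.ColdStartUniversality.LiebRobinson

end
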